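/-
Copyright: the b2b-balaban cell (near-miss cell 7), T⁴-continuum fan-out; row NE7b ROUND-2 swarm, seat
t4-ne7b-formalise-leaf-03 (gen 3) (row S12 «ASSEMBLY», sub-row S12e «THE MULTIPLICITY SOCKET END» of
`t4/b2b-balaban-t4-ne7b-p1/LEAVES-NE7b.md`; the LAST JUNCTION «S12e END v2 × row S6g′'s instance (T3b-4∕T3b-5)», owner's claim table v3.33 (3)).
Released under the licence of the surrounding project.
-/
import Summits.QuantumFields.BalabanUV.T4Continuum.Support.HistoryConstantsTH
import Summits.QuantumFields.BalabanUV.T4Continuum.Support.HistoryBankingLE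
import Summits.QuantumFields.BalabanUV.T4Continuum.Support.HistoryGenFresh
import Summits.QuantumFields.BalabanUV.T4Continuum.Support.HistoryZoneMassTotalFlat

/-!
# History assembly, multiplicity socket: THE LETTERS OF THE LAST JUNCTION (S12e END v2 × row S6g′'s instance)

Summits-side support leaf of the T⁴-continuum cell (rung (B)+1 on a FINITE torus only; NOT infinite volume, NOT the
mass gap, NOT the Clay statement; NOT a proof of the spine estimate NE7b).  Row NE7b, route «COUNT», sub-row S12e and
the LAST JUNCTION booked in the owner's claim table v3.33 (3).  [folklore] finite bookkeeping over the lineage's OWN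
carriers; nothing is quoted from print, nothing printed is asserted, no `[cite:]` tag, no definition, no `Prop` fact.

WHY.  The multiplicity socket END (`HistoryRealiseCellsRunMult.hybridNE7_of_realisedDomainsRun_printedMult`) displays
`hmult : #koccOf … ≤ exp(θ·birthLinT Prod.fst (genT c) + Ξ K (cell, genT c))·Λm^{partnerAges (PEv.step ∘ Prod.fst) (genT c)}`
in the letters of the TAGGED member `genT c` (`birthLinT` = a finset sum over the distinct events of kind `0`), while
row S6g′'s instance (`HistoryJoinsPlacedTwin.card_S_sortR_le_exp_pow`, leaf-05) concludes in the letters of the FLAT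
member `gen c`: `exp(Θ·bsum (fat+1) (gen c) + (8∕φ)·T)·((L^d)·e^4)^{partnerAges PEv.step (gen c)}` times a template
factor.  This file supplies the three identities and the one repackaging that turn the second shape into the first.

WHAT.
* §1 **`birthLinT_eq_bsum`** (generic labels `ε`, shape map `sh`): for a `ConsistentTLE` (births have kind `0`,
  renewals kind `1`, mergers kind `2`) and `FreshT` (events pairwise distinct) genealogy, the class-linear content
  `birthLinT sh G = Σ_{events of kind 0} (fat+1)` IS the tree sum `bsum (fun b => (sh b).fat + 1) G`.
* §2 on pedigrees: `bsum_gen` (`bsum f (P.gen c) = bsum (f ∘ Prod.fst) (P.genT c)`), `partnerAges_gen`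
  (`partnerAges PEv.step (P.gen c) = partnerAges (PEv.step ∘ Prod.fst) (P.genT c)`), and
  **`birthLinT_genT`**: `birthLinT Prod.fst (P.genT c) = bsum (fun b => b.fat + 1) (P.gen c)` for a forest pedigree
  (`freshT_genT`, leaf-09) whose tagged member is `ConsistentTLE` — the letter the junction rewrites (row S6g′'s instance T3b-5 concludes in `bsum` currency).
* §3 **`le_exp_mul_pow_of_twin`** — THE REPACKAGING: a bound `N ≤ A·exp(Θ·B + E)·(Λ·e^4)^p` with `0 < A`, `0 ≤ Λ`
  becomes `N ≤ exp(Θ·B + (E + log A + 4·p))·Λ^p` (the template factor and the `e^4` per partner-age unit move into the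
  allowance; the class-linear part and the partner letter stay where the kernel pays them), and the monotone variant
  `le_exp_mul_pow_of_twin_mono` (`B ≤ B′`, `0 ≤ Θ`).

HONEST SCOPE.  Letters only; nothing of H3 ∕ (B) ∕ BetaPertH is touched; `hmult`∕`hdis` are NOT retired here; NE7b NOT
proved.  HONEST DEPENDENCY (cell): continuum YM on T⁴ ⇐ BetaPertH ∧ nine spine estimates (0/9 proved); BetaPertH ⇐ (D1)
∧ (D4) ∧ CAP+tail; G-an2-4 gates asym, D1 and NE2/3/4.  This file changes none of it.
-/

open Finset
open Literature.MathematicalPhysics.QuantumFieldTheory.Balaban1983to89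
open T4PersistenceDictionary T4PrintedShapeBanking T4TaggedShapeBanking T4PartnerMultiplicity T4BranchingRecordsGas
open Summit.QuantumFields.BalabanUV.T4Continuum.LateMergers
open Summit.QuantumFields.BalabanUV.T4Continuum.HistoryBankingLE
open Summit.QuantumFields.BalabanUV.T4Continuum.HistoryConstants
open Summit.QuantumFields.BalabanUV.T4Continuum.HistoryJoins
open Summit.QuantumFields.BalabanUV.T4Continuum.HistoryGen
open Summit.QuantumFields.BalabanUV.T4Continuum.HistoryZoneMassTotalFlat

namespace Summit.QuantumFields.BalabanUV.T4Continuum.HistoryAssemblyMultLetters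

noncomputable section

/-! ## §1 The class-linear content of a consistent, fresh genealogy is the tree sum of `fat + 1` -/

section Generic

variable {ε : Type*} [DecidableEq ε] (sh : ε → PEv) {C : T4PrintedShapeBanking.Consts} {K : ℕ} {R : ℕ → ℕ}

/-- the filtered event sum defining `birthLinT`, as a function of a finset [folklore] -/
theorem birthLinT_eq_sum_filter (G : Gen ε) :
    birthLinT sh G = ∑ e ∈ G.events with (sh e).kind = 0, (((sh e).fat : ℝ) + 1) := rfl

/-- **`birthLinT = bsum (fat + 1)`** for a `ConsistentTLE`, `FreshT` genealogy: births are the kind-`0` events, each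
counted once. [folklore] -/
theorem birthLinT_eq_bsum :
    ∀ {G : Gen ε}, ConsistentTLE sh C K R G → FreshT G → birthLinT sh G = bsum (fun b => ((sh b).fat : ℝ) + 1) G
  | Gen.born b j, hc, _ => by
      have hk : (sh b).kind = 0 := hc.1
      rw [birthLinT_eq_sum_filter, Gen.events_born, Finset.filter_singleton, if_pos hk, Finset.sum_singleton]
      rfl
  | Gen.renew G e h, hc, hf => by
      simp only [ConsistentTLE] at hc
      simp only [FreshT] at hf
      have hk : ¬ (sh e).kind = 0 := by rw [hc.2.1]; decide
      rw [birthLinT_eq_sum_filter, Gen.events_renew, Finset.filter_insert, if_neg hk, ← birthLinT_eq_sum_filter,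
        birthLinT_eq_bsum hc.1 hf.1]
      rfl
  | Gen.merge X Y e, hc, hf => by
      simp only [ConsistentTLE] at hc
      simp only [FreshT] at hf
      obtain ⟨hX, hY, hk2, -⟩ := hc
      obtain ⟨hfX, hfY, -, -, hd⟩ := hf
      have hk : ¬ (sh e).kind = 0 := by rw [hk2]; decide
      rw [birthLinT_eq_sum_filter, Gen.events_merge, Finset.filter_insert, if_neg hk, Finset.filter_union,
        Finset.sum_union (Finset.disjoint_filter_filter hd), ← birthLinT_eq_sum_filter, ← birthLinT_eq_sum_filter,
        birthLinT_eq_bsum hX hfX, birthLinT_eq_bsum hY hfY]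
      rfl

/-- the inequality form most consumers want: `bsum (fat+1) ≤ birthLinT` (an equality, §1). [folklore] -/
theorem bsum_le_birthLinT {G : Gen ε} (hc : ConsistentTLE sh C K R G) (hf : FreshT G) :
    bsum (fun b => ((sh b).fat : ℝ) + 1) G ≤ birthLinT sh G :=
  (birthLinT_eq_bsum sh hc hf).ge

end Generic

/-! ## §2 On pedigrees: the flat member's letters are the tagged member's letters -/

section Pedigree

variable {α π : Type*} [DecidableEq α] [DecidableEq π] (P : Pedigree α π)

omit [DecidableEq α] [DecidableEq π] in
/-- **`bsum` THROUGH THE TAG-FORGETTING MAP**: `bsum f (gen c) = bsum (f ∘ Prod.fst) (genT c)`. [folklore] -/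
theorem bsum_gen (f : PEv → ℝ) (c : α) : bsum f (P.gen c) = bsum (f ∘ Prod.fst) (P.genT c) := by
  rw [gen_eq_relabel, bsum_relabel]

omit [DecidableEq α] [DecidableEq π] in
/-- **`partnerAges` THROUGH THE TAG-FORGETTING MAP**: `partnerAges PEv.step (gen c) = partnerAges (PEv.step ∘ Prod.fst)
(genT c)`. [folklore] -/
theorem partnerAges_gen (c : α) :
    partnerAges PEv.step (P.gen c) = partnerAges (PEv.step ∘ Prod.fst) (P.genT c) := by
  rw [gen_eq_relabel]
  exact partnerAges_relabel Prod.fst (st := PEv.step ∘ Prod.fst) (st' := PEv.step) (fun _ => rfl) _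

/-- **THE CLASS-LINEAR LETTER OF THE JUNCTION**: for a forest pedigree whose tagged member `genT c` is `ConsistentTLE`,
`birthLinT Prod.fst (genT c) = bsum (fat + 1) (gen c)` (freshness of the tagged member is leaf-09's `freshT_genT`).
[folklore] -/
theorem birthLinT_genT {C : T4PrintedShapeBanking.Consts} {K : ℕ} {R : ℕ → ℕ} (hF : ∀ c, P.Forest c) (c : α)
    (hc : ConsistentTLE Prod.fst C K R (P.genT c)) :
    birthLinT Prod.fst (P.genT c) = bsum (fun b => ((b.fat : ℕ) : ℝ) + 1) (P.gen c) := by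
  rw [birthLinT_eq_bsum Prod.fst hc (Pedigree.freshT_genT hF c), bsum_gen]
  rfl

/-- the inequality form: `bsum (fat + 1) (gen c) ≤ birthLinT Prod.fst (genT c)`. [folklore] -/
theorem bsum_gen_le_birthLinT_genT {C : T4PrintedShapeBanking.Consts} {K : ℕ} {R : ℕ → ℕ} (hF : ∀ c, P.Forest c)
    (c : α) (hc : ConsistentTLE Prod.fst C K R (P.genT c)) :
    bsum (fun b => ((b.fat : ℕ) : ℝ) + 1) (P.gen c) ≤ birthLinT Prod.fst (P.genT c) :=
  (birthLinT_genT P hF c hc).ge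

end Pedigree

/-! ## §3 The repackaging of a twin-currency bound into the socket's currency -/

section Repack

/-- `(Λ·e^4)^p = Λ^p · e^{4p}` [folklore] -/
theorem mul_exp_four_pow (Λ : ℝ) (p : ℕ) : (Λ * Real.exp 4) ^ p = Λ ^ p * Real.exp (4 * (p : ℝ)) := by
  rw [mul_pow, ← Real.exp_nat_mul, mul_comm (p : ℝ) 4]

/-- **THE REPACKAGING**: `N ≤ A·(exp(Θ·B + E)·(Λ·e^4)^p)` with `0 < A` gives
`N ≤ exp(Θ·B + (E + log A + 4·p))·Λ^p` — the template factor `A` and the `e^4` per partner-age unit join the allowance.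
[folklore] -/
theorem le_exp_mul_pow_of_twin {N A Θ B E Λ : ℝ} {p : ℕ} (hA : 0 < A)
    (h : N ≤ A * (Real.exp (Θ * B + E) * (Λ * Real.exp 4) ^ p)) :
    N ≤ Real.exp (Θ * B + (E + Real.log A + 4 * (p : ℝ))) * Λ ^ p := by
  have hre : Real.exp (Θ * B + (E + Real.log A + 4 * (p : ℝ))) * Λ ^ p =
      A * (Real.exp (Θ * B + E) * (Λ * Real.exp 4) ^ p) := by
    rw [mul_exp_four_pow, show Θ * B + (E + Real.log A + 4 * (p : ℝ)) = (Θ * B + E) + Real.log A + 4 * (p : ℝ) by ring,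
      Real.exp_add, Real.exp_add, Real.exp_log hA]
    ring
  rw [hre]
  exact h

/-- **THE REPACKAGING, MONOTONE IN THE CLASS-LINEAR LETTER**: with `0 ≤ Θ` and `B ≤ B′` (e.g. `bsum (fat+1) (gen c) ≤
birthLinT Prod.fst (genT c)`, §2) the bound may be restated on `B′`. [folklore] -/
theorem le_exp_mul_pow_of_twin_mono {N A Θ B B' E Λ : ℝ} {p : ℕ} (hA : 0 < A) (hΘ : 0 ≤ Θ) (hB : B ≤ B') (hΛ : 0 ≤ Λ)
    (h : N ≤ A * (Real.exp (Θ * B + E) * (Λ * Real.exp 4) ^ p)) :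
    N ≤ Real.exp (Θ * B' + (E + Real.log A + 4 * (p : ℝ))) * Λ ^ p := by
  refine (le_exp_mul_pow_of_twin hA h).trans ?_
  refine mul_le_mul_of_nonneg_right (Real.exp_le_exp.2 ?_) (pow_nonneg hΛ p)
  have := mul_le_mul_of_nonneg_left hB hΘ
  linarith

/-- **THE REPACKAGING WITH A GENERIC PER-AGE SURPLUS** `Λ·e^{μ}` (for twins whose partner letter is `L^d·e^{μ}`):
`N ≤ A·(exp(Θ·B + E)·(Λ·e^μ)^p)` ⇒ `N ≤ exp(Θ·B′ + (E + log A + μ·p))·Λ^p`. [folklore] -/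
theorem le_exp_mul_pow_of_twin_mu {N A Θ B B' E Λ μ : ℝ} {p : ℕ} (hA : 0 < A) (hΘ : 0 ≤ Θ) (hB : B ≤ B') (hΛ : 0 ≤ Λ)
    (h : N ≤ A * (Real.exp (Θ * B + E) * (Λ * Real.exp μ) ^ p)) :
    N ≤ Real.exp (Θ * B' + (E + Real.log A + μ * (p : ℝ))) * Λ ^ p := by
  have hpow : (Λ * Real.exp μ) ^ p = Λ ^ p * Real.exp (μ * (p : ℝ)) := by
    rw [mul_pow, ← Real.exp_nat_mul, mul_comm (p : ℝ) μ]
  have hre : Real.exp (Θ * B + (E + Real.log A + μ * (p : ℝ))) * Λ ^ p =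
      A * (Real.exp (Θ * B + E) * (Λ * Real.exp μ) ^ p) := by
    rw [hpow, show Θ * B + (E + Real.log A + μ * (p : ℝ)) = (Θ * B + E) + Real.log A + μ * (p : ℝ) by ring,
      Real.exp_add, Real.exp_add, Real.exp_log hA]
    ring
  rw [← hre] at h
  refine h.trans (mul_le_mul_of_nonneg_right (Real.exp_le_exp.2 ?_) (pow_nonneg hΛ p))
  have := mul_le_mul_of_nonneg_left hB hΘ
  linarith

end Repack

end

end Summit.QuantumFields.BalabanUV.T4Continuum.HistoryAssemblyMultLetters
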